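import Mathlib
import Literature.NumberTheory.Automorphic.GaloisActionPlaces
import Summits.Langlands.Langlands.Theorems.PicardMuOrdinaryResidualAutomorphyEvenFrobRoots

/-!
# The sign of Frobenius and the branch-point table (Stage D1 of `ResidualAutomorphyEven`, concluded)

Helper file for item stmt-Langlands-13760 (route `PicardMuOrdinary`), sequel of `…FrobRoots` (same
notation: `W ∣ v` a prime of `𝓞 M`, `g` an arithmetic Frobenius at `W`, `ρᵢ = xᵢ mod W`).

* `sign_perm4_eq_one_iff` (Stickelberger) — `sign (perm4 g) = 1` iff the discriminant of `f mod v` is a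
  square in `k_v`: Frobenius multiplies `∏_{i<j} (ρⱼ - ρᵢ)` by the sign, and
  `disc (f mod v) = ā⁶ · (∏_{i<j})²` up to the normalisation of `splitQuartic`;
* `inducedPoly_perm4_eq_table` — **D1**: the induced local factor `inducedPoly (perm4 g)` of the
  block-sign character (pairing file: a function of `#Fix` and `sign`) is the five-way branch-point table
  of the route decl at `v`.

Hypotheses: `xᵢ - xⱼ ∉ W` (`i ≠ j`), `a₄ ∉ W`, `2 ∉ W`.  Unconditional.
-/

set_option linter.dupNamespace false -- project-wide option (lakefile weak.linter.dupNamespace); `Summit.Langlands.Langlands` is the mandated namespace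

noncomputable section

namespace Summit.Langlands.Langlands.Theorems.ResidualAutomorphyEven

open Polynomial Equiv Finset NumberField Pairing
open scoped Classical

variable {f : ℤ[X]}

section Residue

-- residue rings of maximal ideals are fields (Mathlib keeps this a `def` to avoid diamonds)
attribute [local instance] Ideal.Quotient.field

variable (h : IsSepQuartic f) (W : Ideal (𝓞 (M f))) (v : IsDedekindDomain.HeightOneSpectrum (𝓞 K))
  (hv : v.asIdeal = W.under (𝓞 K))

/-! ### The sign of Frobenius and the discriminant (Stickelberger) -/

/-- Scaling all four entries scales `prodPairs` by the sixth power. -/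
theorem prodPairs_mul_four {R : Type*} [CommRing R] (c : R) (z : Fin 4 → R) :
    prodPairs (fun i => c * z i) = c ^ 6 * prodPairs z := by
  simp only [prodPairs, prod_Ioi_four]
  ring

include hv in
/-- **`f mod W` is the split quartic `ā ∏ (X - ρᵢ/ā)`** (from the reduced identity). -/
theorem fbar_map_eq_splitQuartic [W.IsMaximal] (ha : abar W ≠ 0) :
    (fbar f v).map (iota W v hv) = splitQuartic (abar W) (fun i => (abar W)⁻¹ * rho h W i) := by
  have key := C_abar_pow_mul_eq_prod h W v hv
  have hfac : ∀ i : Fin 4, (C (abar W) * X - C (rho h W i) : (𝓞 (M f) ⧸ W)[X]) =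
      C (abar W) * (X - C ((abar W)⁻¹ * rho h W i)) := by
    intro i
    rw [mul_sub, ← C_mul, mul_inv_cancel_left₀ ha]
  simp only [hfac, Finset.prod_mul_distrib, Finset.prod_const, Finset.card_univ, Fintype.card_fin] at key
  have hC : (C (abar W) ^ 3 : (𝓞 (M f) ⧸ W)[X]) ≠ 0 := pow_ne_zero _ (by rwa [Ne, C_eq_zero])
  apply mul_left_cancel₀ hC
  rw [key]
  unfold splitQuartic prodFour
  rw [Fin.prod_univ_four]
  ring

include h hv in
/-- `f mod v` has degree `4` (for `ā ≠ 0`). -/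
theorem natDegree_fbar [W.IsMaximal] (ha : abar W ≠ 0) : (fbar f v).natDegree = 4 := by
  have ha0 : abarv f v ≠ 0 := fun h0 => ha (by rw [← iota_abarv W v hv, h0, map_zero])
  have hf4 : f.natDegree = 4 := by
    have := h.1; rwa [fK, natDegree_map_eq_of_injective (algebraMap ℤ K).injective_int] at this
  rw [fbar, natDegree_map_of_leadingCoeff_ne_zero, hf4]
  exact ha0

include hv in
/-- **Stickelberger for the quartic**: `sign (perm4 g) = 1` iff the discriminant of `f mod v` is a
square in `k_v` (both say that `∏_{i<j} (ρⱼ - ρᵢ)` is fixed by the `q`-th power map, i.e. lies in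
`k_v`; `2 ∉ W` separates `d` from `-d`). -/
theorem sign_perm4_eq_one_iff [W.IsMaximal] {g : G f} (hg : IsArithFrobAt (𝓞 K) g W)
    (hW : ∀ i j, i ≠ j → xInt h i - xInt h j ∉ W) (ha : abar W ≠ 0) (h2 : (2 : 𝓞 (M f)) ∉ W) :
    Perm.sign (perm4 h g) = 1 ↔ ∃ y : 𝓞 K ⧸ v.asIdeal, y ^ 2 = (fbar f v).discr := by
  haveI := v.isMaximal
  have hinj := iota_injective W v hv
  have hρ := rho_injective (h := h) hW
  set ι := iota W v hv with hι
  set a := abar W with haa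
  set d := prodPairs (rho h W) with hd
  have hd0 : d ≠ 0 := prodPairs_ne_zero hρ
  have hdq : d ^ qW W = ((Perm.sign (perm4 h g) : ℤ) : 𝓞 (M f) ⧸ W) * d := prodPairs_rho_pow hg
  -- the discriminant of `f mod v`, pushed to `k`, is `(a⁻³ d)²`
  have hdisc : ι (fbar f v).discr = ((a⁻¹) ^ 3 * d) ^ 2 := by
    have hdeg : 0 < (fbar f v).degree := by
      rw [← natDegree_pos_iff_degree_pos, natDegree_fbar h W v hv ha]; norm_num
    rw [← discr_map_of_injective ι hinj _ hdeg, hι, fbar_map_eq_splitQuartic h W v hv ha,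
      discr_splitQuartic _ ha, ← haa]
    change a ^ 6 * (prodPairs fun i => a⁻¹ * rho h W i) ^ 2 = _
    rw [prodPairs_mul_four, ← hd]
    have hinv : a * a⁻¹ = 1 := mul_inv_cancel₀ ha
    have h6 : a ^ 6 * (a⁻¹) ^ 12 = (a⁻¹) ^ 6 := by
      rw [show (a⁻¹) ^ 12 = (a⁻¹) ^ 6 * (a⁻¹) ^ 6 by ring, ← mul_assoc, ← mul_pow, hinv, one_pow, one_mul]
    linear_combination d ^ 2 * h6
  -- `a`, `a⁻¹` lie in the image of `k_v`
  have ha_mem : a = ι (abarv f v) := (iota_abarv W v hv).symm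
  -- (1) square class ↔ `a⁻³ d ∈ ι(k_v)` ↔ `d ∈ ι(k_v)`
  have h1 : (∃ y : 𝓞 K ⧸ v.asIdeal, y ^ 2 = (fbar f v).discr) ↔ d ∈ Set.range ι := by
    constructor
    · rintro ⟨y, hy⟩
      have hsq : (ι y) ^ 2 = ((a⁻¹) ^ 3 * d) ^ 2 := by rw [← map_pow, hy, hdisc]
      rcases (sq_eq_sq_iff_eq_or_eq_neg.mp hsq.symm) with he | he
      · refine ⟨abarv f v ^ 3 * y, ?_⟩
        rw [map_mul, map_pow, ← ha_mem, ← he, ← mul_assoc, ← mul_pow, mul_inv_cancel₀ ha, one_pow, one_mul]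
      · refine ⟨-(abarv f v ^ 3 * y), ?_⟩
        rw [map_neg, map_mul, map_pow, ← ha_mem, neg_mul_eq_mul_neg, ← he, ← mul_assoc, ← mul_pow,
          mul_inv_cancel₀ ha, one_pow, one_mul]
    · rintro ⟨t, ht⟩
      refine ⟨(abarv f v)⁻¹ ^ 3 * t, hinj ?_⟩
      rw [map_pow, hdisc, map_mul, map_pow, map_inv₀, ← ha_mem, ht]
  -- (2) `d ∈ ι(k_v)` ↔ `d ^ q = d` ↔ `sign = 1`
  have h2k : (2 : 𝓞 (M f) ⧸ W) ≠ 0 := fun h0 => h2 ((Ideal.Quotient.eq_zero_iff_mem).mp (by exact_mod_cast h0))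
  rw [h1, FiniteField.mem_range_iff_pow_card_eq, ← qW_eq_card W v hv, hdq]
  constructor
  · intro hs; rw [hs]; simp
  · intro hfix
    rcases Int.units_eq_one_or (Perm.sign (perm4 h g)) with hs | hs
    · exact hs
    · exfalso
      rw [hs] at hfix
      simp only [Units.val_neg, Units.val_one, Int.cast_neg, Int.cast_one, neg_mul, one_mul] at hfix
      have : (2 : 𝓞 (M f) ⧸ W) * d = 0 := by linear_combination -hfix
      rcases mul_eq_zero.mp this with h0 | h0
      · exact h2k h0
      · exact hd0 h0

/-! ### Conclusion: the induced local factor at a Frobenius is the branch-point table at `v` -/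

include hv in
/-- **D1.** For an arithmetic Frobenius `g` at a good prime `W ∣ v` of `𝓞 M`, the induced local factor
`inducedPoly (perm4 g)` of the block-sign character (pairing file) is the route's branch-point table
polynomial at `v`: indexed by the number of roots of `f mod v` and the square class of its
discriminant. -/
theorem inducedPoly_perm4_eq_table [W.IsMaximal] {g : G f} (hg : IsArithFrobAt (𝓞 K) g W)
    (hW : ∀ i j, i ≠ j → xInt h i - xInt h j ∉ W) (ha : abar W ≠ 0) (h2 : (2 : 𝓞 (M f)) ∉ W) :
    inducedPoly (perm4 h g) =
      (if (fbar f v).roots.toFinset.card = 4 then (X - 1) ^ 3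
        else if (fbar f v).roots.toFinset.card = 2 then (X - 1) ^ 2 * (X + 1)
        else if (fbar f v).roots.toFinset.card = 1 then X ^ 3 - 1
        else if (∃ y : 𝓞 K ⧸ v.asIdeal, y ^ 2 = (fbar f v).discr) then (X - 1) * (X + 1) ^ 2
        else X ^ 3 + X ^ 2 + X + 1 : ℤ[X]) := by
  rw [inducedPoly_eq_tablePoly, fixedCard_perm4_eq h W v hv hg hW ha, tablePoly]
  by_cases hs : Perm.sign (perm4 h g) = 1
  · have hs' := (sign_perm4_eq_one_iff h W v hv hg hW ha h2).mp hs
    simp only [hs, hs', if_true]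
  · have hs' : ¬ ∃ y : 𝓞 K ⧸ v.asIdeal, y ^ 2 = (fbar f v).discr :=
      fun h' => hs ((sign_perm4_eq_one_iff h W v hv hg hW ha h2).mpr h')
    simp only [hs, hs', if_false]

end Residue

end Summit.Langlands.Langlands.Theorems.ResidualAutomorphyEven
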